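import Summits.BirchSwinnertonDyer.BirchSwinnertonDyer.Theorems.PrintCf2RamifiedOffTYZMoverSquaresSix
import Summits.BirchSwinnertonDyer.BirchSwinnertonDyer.Theorems.PrintCf2RamifiedOffTYZMoverBlockForm
import Summits.BirchSwinnertonDyer.BirchSwinnertonDyer.Theorems.PrintCf2RamifiedOffTYZMoverKummerBits
import HarnessLib

/-!
# Crux `PrintCf2.RamifiedOffTYZOfFacts` (stmt-BirchSwinnertonDyer-20509), line `offtyz-v7`, LEAD cycle 9 (cruxlead-20509 g8):
# THE CHARACTER `χ_d` OF A CM BLOCK WITHOUT ANY RING CLASS GROUP, AND THE FROBENIUS ROWS OF A BLOCK `d ≡ 6 (mod 8)`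

THEOREMS ONLY (no `def`, no named fact, no `sorry`), `--supports stmt-BirchSwinnertonDyer-20509`; step (E2′) of the even mover programme
(crux workfile `Lines/offtyz_v7_SevenSector.md` §9).

SETTING.  `D : GenusPointData n`, `n` square-free, a CM block `d ∣ n` with `D.CMBlockSpec d z Φ ΓH ΓH' σ c` (so `d ≡ 5` or `6 (mod 8)`), and
`χ_d(g) := [(g·g)^{g(d)} σ⁻¹ ∈ Gal(ℍ′_n/H′_d)]` for `g ∈ Gal(ℍ′_n/K_d)` — by `galPt_mul_self_Z_eq_add_ite_all` (p703022) the indicator of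
«`g·g` moves `Z(d)`».
* §1 **`χ_d` IS ADDITIVE on `Gal(ℍ′_n/K_d)`, with NO ring class dictionary** (`chi_mul_of_cmBlockSpec`): `g·g` is trivial on `L_d(i)`, so THEOREM B
  (`galPt_genusPeriod_dichotomy_of_cmBlockSpec_all`) puts `(g·g)^{g(d)}` in `Γ′ ∪ σΓ′` (`Γ′ = Gal(ℍ′_n/H′_d)`); `K_d`-automorphisms commute modulo `Γ′`
  ((G3)), so `(gh·gh)^{g(d)} ≡ (gg)^{g(d)}(hh)^{g(d)}`, and `[ab ≡ σ] = [a ≡ σ] + [b ≡ σ]` on `{1, σ̄}`.  (g7's `chi_mul` needed `Pic(𝒪₂)` and `d ≡ 5`.)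
  `χ_d` kills every `L_d(i)`-trivial element (`chi_eq_zero_of_trivialOnL_of_cmBlockSpec`) and every involution modulo `Γ′`
  (`chi_eq_zero_of_mul_self_mem_of_cmBlockSpec`); and `χ_d(θ) = [g(d) odd]` for any `θ` with `θθσ⁻¹ ∈ Γ′` (`chi_theta_iff`; for `d ≡ 6` this is
  TYZ's `σ_{1+ϖ}`, `ThetaBlockSpec`).
* §2 **Frobenius rows** (`bits_eq_row_of_frobenius_six`): for `d = 2·q₁⋯q_m` and the Frobenius element `φ_j` of the ramified prime `𝔭_{q_j}` in the
  conductor-`4` ring class field (the printed sentence (F1)–(F3) with conductor `4`, taken as a hypothesis `hFrob` pending its display), the bit vector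
  `([φ_j moves i√−q_i])_i ; [φ_j moves i√−2])` is the `j`-th row of `N_d := [[A_d + D₋₂, z_d], [0, 0]]` (`z = ((2/q)₊)`, index `Fin m ⊕ Unit`).
The block form itself (`χ_d = kerSum N_d · x_d` in the genus regime) is the sequel `…MoverBlockFormSix`.
BSD is not proved by any of this; no class is closed by this file.

References: [cite: TianYuanZhang2017, §3.1 (p0011 L1–L13, L53–L64), Prop. 3.2 (2) (p0010 L111–L113), Thm. 3.6 (2) (p0012 L31–L33), proof of Lemma 3.21
(p0020 L50–L63)]; [cite: Cox2013, §5.C Lemma 5.19 and (5.22), §9.A (pp. 180–181)]; [cite: HeathBrown1994SelmerCongruentII, Appendix (Monsky), typescript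
p. 41 L20–L36]; crux notes `Lines/offtyz_v7_SevenSector.md` §9, `Lines/offtyz_v7_QForm.md` §8.
-/

noncomputable section

open scoped Classical NumberField

open WeierstrassCurve WeierstrassCurve.Affine Finset Matrix Literature.NumberTheory.EllipticCurves
  Literature.NumberTheory.EllipticCurves.TianYuanZhang2017
  Literature.NumberTheory.EllipticCurves.TianYuanZhang2017.W2
  Literature.NumberTheory.EllipticCurves.HeathBrown1994
  Literature.NumberTheory.EllipticCurves.HeathBrown1994.Families
  Literature.NumberTheory.EllipticCurves.Smith2016
  Summit.BirchSwinnertonDyer.Rank1Residual.P2.GenusPeriodTransferLayer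
  Summit.BirchSwinnertonDyer.PrintCf2.QForm

set_option autoImplicit false

namespace Summit.BirchSwinnertonDyer.PrintCf2.MoverAssembly

variable {n : ℕ} (D : GenusPointData n)

/-! ## §1 `χ_d` is additive on every CM block — no ring class group -/

section Character

variable {d : ℕ} {z : APoint D.H} {Φ : Finset (D.H ≃ₐ[ℚ] D.H)} {ΓH ΓH' : Subgroup (D.H ≃ₐ[ℚ] D.H)} {σ c : D.H ≃ₐ[ℚ] D.H}

/-- In a group, membership `x·σ⁻¹ ∈ Γ′` for a NORMAL subgroup `Γ′` is the equation `x̄ = σ̄` in the quotient. [folklore] -/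
theorem mul_inv_mem_iff_mk_eq {G : Type*} [Group G] (N : Subgroup G) [N.Normal] (x y : G) :
    x * y⁻¹ ∈ N ↔ (QuotientGroup.mk' N) x = (QuotientGroup.mk' N) y := by
  rw [QuotientGroup.mk'_apply, QuotientGroup.mk'_apply, QuotientGroup.eq_iff_div_mem, div_eq_mul_inv]

/-- **The class of `(g·g)^{g(d)}` modulo `Gal(ℍ′_n/H′_d)` is `1` or `σ̄`**, for EVERY automorphism `g` of `ℍ′_n` (its square is trivial on `L_d(i)`;
THEOREM B on every CM block). [cite: TianYuanZhang2017, Prop. 3.2 (1)(2), Thm. 3.6 (1)(2), proof of Lemma 3.21 (p0020 L55–L62)] -/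
theorem mul_self_pow_gK_mem_or (hd : d ∈ n.divisors) (hd1 : 1 < d) (h : D.CMBlockSpec d z Φ ΓH ΓH' σ c) (g : D.H ≃ₐ[ℚ] D.H) :
    (g * g) ^ gK d ∈ ΓH' ∨ (g * g) ^ gK d * σ⁻¹ ∈ ΓH' :=
  (galPt_genusPeriod_dichotomy_of_cmBlockSpec_all D hd1 h (trivialOnL_mul_self_of_mem_divisors D g hd)).imp And.left And.left

/-- **`χ_d` is ADDITIVE on `Gal(ℍ′_n/K_d)`**: for `g, g′` fixing `√−d`,
`[(gg′·gg′)^{g(d)}σ⁻¹ ∈ Γ′] = [(gg)^{g(d)}σ⁻¹ ∈ Γ′] + [(g′g′)^{g(d)}σ⁻¹ ∈ Γ′]` (`Γ′ = Gal(ℍ′_n/H′_d)`; every CM block, no ring class dictionary).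
[cite: TianYuanZhang2017, §3.1 (p0011 L1–L13: Cl′ abelian), Prop. 3.2 (1)(2), proof of Lemma 3.21 (p0020 L55–L62)] -/
theorem chi_mul_of_cmBlockSpec (hd : d ∈ n.divisors) (hd1 : 1 < d) (h : D.CMBlockSpec d z Φ ΓH ΓH' σ c) {g g' : D.H ≃ₐ[ℚ] D.H}
    (hg : g (D.sqrtNeg d) = D.sqrtNeg d) (hg' : g' (D.sqrtNeg d) = D.sqrtNeg d) :
    (if ((g * g') * (g * g')) ^ gK d * σ⁻¹ ∈ ΓH' then (1 : ZMod 2) else 0) =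
      (if (g * g) ^ gK d * σ⁻¹ ∈ ΓH' then (1 : ZMod 2) else 0) + (if (g' * g') ^ gK d * σ⁻¹ ∈ ΓH' then (1 : ZMod 2) else 0) := by
  have hσΓ' : σ ∉ ΓH' := sigma_not_mem D ΓH' z σ h.2.2.1.1 h.2.2.2.2.2.1.2.2
  have hgg := mul_self_pow_gK_mem_or D hd hd1 h g
  have hgg' := mul_self_pow_gK_mem_or D hd hd1 h g'
  obtain ⟨-, -, ⟨-, hΓn, hcomm⟩, -, -, ⟨-, hσσ, -⟩, -, -⟩ := h
  haveI hN : ΓH'.Normal := ⟨fun γ hγ x => hΓn x γ hγ⟩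
  set φ := QuotientGroup.mk' ΓH' with hφ
  have hone : ∀ x : D.H ≃ₐ[ℚ] D.H, x ∈ ΓH' → φ x = 1 := fun x hx => by
    rw [hφ, QuotientGroup.mk'_apply, QuotientGroup.eq_one_iff]; exact hx
  have hκ1 : φ σ ≠ 1 := fun e => hσΓ' (by rwa [hφ, QuotientGroup.mk'_apply, QuotientGroup.eq_one_iff] at e)
  -- the classes of `(gg)^N`, `(g'g')^N`
  have hcls : ∀ x : D.H ≃ₐ[ℚ] D.H, ((x * x) ^ gK d ∈ ΓH' ∨ (x * x) ^ gK d * σ⁻¹ ∈ ΓH') →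
      (φ ((x * x) ^ gK d) = 1 ∨ φ ((x * x) ^ gK d) = φ σ) := by
    intro x hx
    rcases hx with hx | hx
    · exact Or.inl (hone _ hx)
    · exact Or.inr ((mul_inv_mem_iff_mk_eq ΓH' _ _).mp hx)
  -- commutation of `φ g`, `φ g'`
  have hc : Commute (φ g) (φ g') := by
    have h1 : φ (g⁻¹ * g'⁻¹ * g * g') = 1 := hone _ (hcomm g g' hg hg')
    rw [map_mul, map_mul, map_mul, map_inv, map_inv] at h1
    show φ g * φ g' = φ g' * φ g
    calc φ g * φ g' = φ g' * φ g * ((φ g)⁻¹ * (φ g')⁻¹ * φ g * φ g') := by group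
      _ = φ g' * φ g := by rw [h1, mul_one]
  have e : φ (((g * g') * (g * g')) ^ gK d) = φ ((g * g) ^ gK d) * φ ((g' * g') ^ gK d) := by
    simp only [map_pow, map_mul]
    have e1 : φ g * φ g' * (φ g * φ g') = (φ g * φ g) * (φ g' * φ g') := by
      calc φ g * φ g' * (φ g * φ g') = φ g * (φ g' * φ g) * φ g' := by group
        _ = φ g * (φ g * φ g') * φ g' := by rw [hc.eq]
        _ = (φ g * φ g) * (φ g' * φ g') := by group
    rw [e1]
    exact ((hc.mul_left hc).mul_right (hc.mul_left hc)).mul_pow (gK d)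
  have hκκ : φ σ * φ σ = 1 := by rw [← map_mul]; exact hone _ hσσ
  have hP : ((g * g') * (g * g')) ^ gK d * σ⁻¹ ∈ ΓH' ↔ φ (((g * g') * (g * g')) ^ gK d) = φ σ := mul_inv_mem_iff_mk_eq ΓH' _ _
  have hQ : (g * g) ^ gK d * σ⁻¹ ∈ ΓH' ↔ φ ((g * g) ^ gK d) = φ σ := mul_inv_mem_iff_mk_eq ΓH' _ _
  have hR : (g' * g') ^ gK d * σ⁻¹ ∈ ΓH' ↔ φ ((g' * g') ^ gK d) = φ σ := mul_inv_mem_iff_mk_eq ΓH' _ _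
  rcases hcls g hgg with ha | ha <;> rcases hcls g' hgg' with hb | hb
  · have hc1 : φ (((g * g') * (g * g')) ^ gK d) = 1 := by rw [e, ha, hb, mul_one]
    rw [if_neg (fun hm => hκ1 ((hP.mp hm).symm.trans hc1)), if_neg (fun hm => hκ1 ((hQ.mp hm).symm.trans ha)),
      if_neg (fun hm => hκ1 ((hR.mp hm).symm.trans hb)), add_zero]
  · have hc1 : φ (((g * g') * (g * g')) ^ gK d) = φ σ := by rw [e, ha, hb, one_mul]
    rw [if_pos (hP.mpr hc1), if_neg (fun hm => hκ1 ((hQ.mp hm).symm.trans ha)), if_pos (hR.mpr hb), zero_add]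
  · have hc1 : φ (((g * g') * (g * g')) ^ gK d) = φ σ := by rw [e, ha, hb, mul_one]
    rw [if_pos (hP.mpr hc1), if_pos (hQ.mpr ha), if_neg (fun hm => hκ1 ((hR.mp hm).symm.trans hb)), add_zero]
  · have hc1 : φ (((g * g') * (g * g')) ^ gK d) = 1 := by rw [e, ha, hb, hκκ]
    rw [if_neg (fun hm => hκ1 ((hP.mp hm).symm.trans hc1)), if_pos (hQ.mpr ha), if_pos (hR.mpr hb)]
    decide

/-- **`χ_d` kills every `L_d(i)`-trivial element**: `(t·t)^{g(d)}σ⁻¹ ∉ Gal(ℍ′_n/H′_d)` (`t^{g(d)} ≡ 1` or `σ`, so `(tt)^{g(d)} ≡ 1`).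
[cite: TianYuanZhang2017, proof of Lemma 3.21 (p0020 L55–L62)] -/
theorem chi_eq_zero_of_trivialOnL_of_cmBlockSpec (hd1 : 1 < d) (h : D.CMBlockSpec d z Φ ΓH ΓH' σ c) {t : D.H ≃ₐ[ℚ] D.H}
    (ht : D.TrivialOnL d t) : ¬ ((t * t) ^ gK d * σ⁻¹ ∈ ΓH') := by
  have hσΓ' : σ ∉ ΓH' := sigma_not_mem D ΓH' z σ h.2.2.1.1 h.2.2.2.2.2.1.2.2
  have hdich := galPt_genusPeriod_dichotomy_of_cmBlockSpec_all D hd1 h ht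
  obtain ⟨-, -, ⟨-, hΓn, -⟩, -, -, ⟨-, hσσ, -⟩, -, -⟩ := h
  haveI hN : ΓH'.Normal := ⟨fun γ hγ x => hΓn x γ hγ⟩
  set φ := QuotientGroup.mk' ΓH' with hφ
  have hone : ∀ x : D.H ≃ₐ[ℚ] D.H, φ x = 1 ↔ x ∈ ΓH' := fun x => by
    rw [hφ, QuotientGroup.mk'_apply, QuotientGroup.eq_one_iff]
  -- `φ (t^N) ^ 2 = 1`
  have hsq : φ (t ^ gK d) * φ (t ^ gK d) = 1 := by
    rcases hdich with ⟨h1, -⟩ | ⟨h1, -⟩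
    · rw [(hone _).mpr h1, mul_one]
    · have e : φ (t ^ gK d) = φ σ := (mul_inv_mem_iff_mk_eq ΓH' _ _).mp h1
      rw [e, ← map_mul]; exact (hone _).mpr hσσ
  have hmem : (t * t) ^ gK d ∈ ΓH' := by
    rw [← hone, (Commute.refl t).mul_pow, map_mul, hsq]
  intro hbad
  apply hσΓ'
  have := ΓH'.mul_mem (ΓH'.inv_mem hbad) hmem
  rwa [_root_.mul_inv_rev, inv_inv, mul_assoc, inv_mul_cancel, mul_one] at this

/-- **`χ_d` kills every involution modulo `Gal(ℍ′_n/H′_d)`** (e.g. the Frobenius element of a ramified odd prime of the ring class field of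
conductor `2` or `4`: `𝔭_q² = q𝒪_K` is trivial). [cite: TianYuanZhang2017, Prop. 3.2 (1)(2)] [cite: Cox2013, §9.A] -/
theorem chi_eq_zero_of_mul_self_mem_of_cmBlockSpec (h : D.CMBlockSpec d z Φ ΓH ΓH' σ c) {φ₀ : D.H ≃ₐ[ℚ] D.H}
    (hφ₀ : φ₀ * φ₀ ∈ ΓH') : ¬ ((φ₀ * φ₀) ^ gK d * σ⁻¹ ∈ ΓH') := by
  have hσΓ' : σ ∉ ΓH' := sigma_not_mem D ΓH' z σ h.2.2.1.1 h.2.2.2.2.2.1.2.2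
  intro hbad
  apply hσΓ'
  have := ΓH'.mul_mem (ΓH'.inv_mem hbad) (ΓH'.pow_mem hφ₀ (gK d))
  rwa [_root_.mul_inv_rev, inv_inv, mul_assoc, inv_mul_cancel, mul_one] at this

/-- **`χ_d(θ) = [g(d) odd]`** for any `θ` with `θθσ⁻¹ ∈ Gal(ℍ′_n/H′_d)` (`d ≡ 6 (mod 8)`: TYZ's `σ_{1+ϖ}`, `ThetaBlockSpec`; then `(θθ)^{g(d)} ≡ σ^{g(d)}`).
[cite: TianYuanZhang2017, Prop. 3.2 (2) (p0010 L111–L113), Thm. 3.6 (2) (p0012 L31–L33)] -/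
theorem chi_theta_iff (h : D.CMBlockSpec d z Φ ΓH ΓH' σ c) {θ : D.H ≃ₐ[ℚ] D.H} (hθ : θ * θ * σ⁻¹ ∈ ΓH') :
    (θ * θ) ^ gK d * σ⁻¹ ∈ ΓH' ↔ Odd (gK d) := by
  have hσΓ' : σ ∉ ΓH' := sigma_not_mem D ΓH' z σ h.2.2.1.1 h.2.2.2.2.2.1.2.2
  obtain ⟨-, -, ⟨-, hΓn, -⟩, -, -, ⟨-, hσσ, -⟩, -, -⟩ := h
  haveI hN : ΓH'.Normal := ⟨fun γ hγ x => hΓn x γ hγ⟩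
  set φ := QuotientGroup.mk' ΓH' with hφ
  have hone : ∀ x : D.H ≃ₐ[ℚ] D.H, φ x = 1 ↔ x ∈ ΓH' := fun x => by
    rw [hφ, QuotientGroup.mk'_apply, QuotientGroup.eq_one_iff]
  have hθσ : φ (θ * θ) = φ σ := (mul_inv_mem_iff_mk_eq ΓH' _ _).mp hθ
  have hσ2 : φ σ ^ 2 = 1 := by rw [sq, ← map_mul]; exact (hone _).mpr hσσ
  rw [mul_inv_mem_iff_mk_eq ΓH', map_pow, hθσ]
  constructor
  · intro hpow
    by_contra hev
    rw [Nat.not_odd_iff_even] at hev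
    obtain ⟨r, hr⟩ := hev
    rw [hr, ← two_mul, pow_mul, hσ2, one_pow] at hpow
    exact hσΓ' ((hone σ).mp hpow.symm)
  · rintro ⟨r, hr⟩
    rw [hr, pow_succ, pow_mul, hσ2, one_pow, one_mul]

end Character

/-! ## §2 Frobenius rows of a block `d = 2·q₁⋯q_m` -/

/-- Additive symbols are additive on products of symbols `±1`. [cite: IrelandRosen1990, Ch. 5 §1 Prop. 5.1.2] -/
theorem addLegendreSym_mul_of_ne_zero {a b : ℤ} {p : ℕ} (ha : jacobiSym a p = 1 ∨ jacobiSym a p = -1)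
    (hb : jacobiSym b p = 1 ∨ jacobiSym b p = -1) :
    addLegendreSym (a * b) p = addLegendreSym a p + addLegendreSym b p := by
  rw [addLegendreSym_def (a * b), jacobiSym.mul_left, addLegendreSym_def a, addLegendreSym_def b]
  rcases ha with ha | ha <;> rcases hb with hb | hb <;> rw [ha, hb] <;> decide

variable {m : ℕ} (q : Fin m → ℕ) (hq : ∀ j, (q j).Prime) (hqodd : ∀ j, Odd (q j)) (hqinj : Function.Injective q)

omit hq hqodd hqinj in
/-- `∏_j (2; q)_j = 2·∏ q` for the extended prime family `Fin.cons 2 q`. [folklore] -/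
theorem prod_cons_two_eq : ∏ j, (Fin.cons 2 q : Fin (m + 1) → ℕ) j = 2 * ∏ j, q j :=
  Fin.prod_cons 2 q

include hq hqodd hqinj in
/-- **The bit vector of a Frobenius element `φ_j` of a block `d = 2·q₁⋯q_m` is the `j`-th ROW of `N_d = [[A_d + D₋₂, z_d],[0,0]]`.**  From
Euler's criterion (`φ_j(i) = (−1/q_j)·i`, `φ_j(√−2) = (−2/q_j)·√−2`, `φ_j(√−q_i) = (−q_i/q_j)·√−q_i` for `i ≠ j`): `[φ_j moves i√−q_i] = (q_i/q_j)₊ = A_{ji}`,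
`[φ_j moves i√−2] = (2/q_j)₊`; and from `φ_j(√−d) = √−d`: `[φ_j moves i√−q_j] = (−1/q_j)₊ + (2/q_j)₊ + Σ_{i≠j} A_{ji} = (A + D₋₂)_{jj}`.
[cite: TianYuanZhang2017, §3.1 (p0011 L60–L64)] [cite: Cox2013, §5.C Lemma 5.19, (5.22)]
[cite: HeathBrown1994SelmerCongruentII, Appendix (Monsky), typescript p. 41 L20–L36] -/
theorem bits_eq_row_of_frobenius_six {d : ℕ} (hd : d ∈ n.divisors) (hprod : 2 * ∏ j, q j = d) (j : Fin m) {φ : D.H ≃ₐ[ℚ] D.H}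
    (hφd : φ (D.sqrtNeg d) = D.sqrtNeg d) (hφi : φ D.im = (jacobiSym (-1) (q j)) • D.im)
    (hφ2 : φ (D.sqrtNeg 2) = (jacobiSym (-2) (q j)) • D.sqrtNeg 2)
    (hφq : ∀ i, i ≠ j → φ (D.sqrtNeg (q i)) = (jacobiSym (-(q i : ℤ)) (q j)) • D.sqrtNeg (q i)) (c : Fin m ⊕ Unit) :
    Sum.elim (fun i => if φ (D.im * D.sqrtNeg (q i)) = D.im * D.sqrtNeg (q i) then (0 : ZMod 2) else 1)
        (fun _ => if φ (D.im * D.sqrtNeg 2) = D.im * D.sqrtNeg 2 then (0 : ZMod 2) else 1) c =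
      Matrix.fromBlocks (legendreMatrix q + legendreDiagonal q (-2)) (Matrix.of fun j (_ : Unit) => addLegendreSym 2 (q j))
        (0 : Matrix Unit (Fin m) (ZMod 2)) (0 : Matrix Unit Unit (ZMod 2)) (Sum.inl j) c := by
  have hprod' : ∏ l, (Fin.cons 2 q : Fin (m + 1) → ℕ) l = d := by rw [prod_cons_two_eq q, hprod]
  have hqn' : ∀ l, (Fin.cons 2 q : Fin (m + 1) → ℕ) l ∈ n.divisors := mem_divisors_of_block (Fin.cons 2 q) hd hprod'
  have hqn : ∀ i, q i ∈ n.divisors := fun i => by simpa only [Fin.cons_succ] using hqn' i.succ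
  have h2n : 2 ∈ n.divisors := by simpa only [Fin.cons_zero] using hqn' 0
  haveI : Fact (1 < q j) := ⟨(hq j).one_lt⟩
  have hJi : jacobiSym (-1) (q j) = 1 ∨ jacobiSym (-1) (q j) = -1 :=
    jacobiSym_eq_one_or_neg_one_of_prime (hq j) (by rw [Int.cast_neg, Int.cast_one, neg_ne_zero]; exact one_ne_zero)
  have h2q : ((2 : ℤ) : ZMod (q j)) ≠ 0 := by
    have := natCast_zmod_ne_zero_of_prime_ne (hq j) Nat.prime_two (fun h => by
      have := hqodd j; rw [← h] at this; exact (Nat.not_odd_iff_even.mpr even_two) this)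
    exact_mod_cast this
  have hJ2 : jacobiSym 2 (q j) = 1 ∨ jacobiSym 2 (q j) = -1 := jacobiSym_eq_one_or_neg_one_of_prime (hq j) h2q
  -- the bit of `i`
  have hbi : (if φ D.im = D.im then (0 : ZMod 2) else 1) = addLegendreSym (-1) (q j) := by
    rw [hφi, bit_zsmul_eq_addLegendreSym D.im_ne_zero hJi]
  -- the bit of `i√−2`
  have hb2 : (if φ (D.im * D.sqrtNeg 2) = D.im * D.sqrtNeg 2 then (0 : ZMod 2) else 1) = addLegendreSym 2 (q j) := by
    have hmul : φ (D.im * D.sqrtNeg 2) = (jacobiSym 2 (q j)) • (D.im * D.sqrtNeg 2) := by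
      rw [map_mul, hφi, hφ2, smul_mul_smul_comm, ← jacobiSym.mul_left, show (-1 : ℤ) * -2 = 2 by ring]
    rw [hmul, bit_zsmul_eq_addLegendreSym (im_mul_sqrtNeg_ne_zero D h2n) hJ2]
  -- off-diagonal prime bits
  have hoff : ∀ i, i ≠ j → (if φ (D.im * D.sqrtNeg (q i)) = D.im * D.sqrtNeg (q i) then (0 : ZMod 2) else 1) = legendreMatrix q j i := by
    intro i hij
    have hq0 : ((q i : ℤ) : ZMod (q j)) ≠ 0 := by
      rw [Int.cast_natCast]; exact natCast_zmod_ne_zero_of_prime_ne (hq j) (hq i) fun h => hij (hqinj h)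
    have hJq : jacobiSym (q i : ℤ) (q j) = 1 ∨ jacobiSym (q i : ℤ) (q j) = -1 := jacobiSym_eq_one_or_neg_one_of_prime (hq j) hq0
    have hmul : φ (D.im * D.sqrtNeg (q i)) = (jacobiSym (q i : ℤ) (q j)) • (D.im * D.sqrtNeg (q i)) := by
      rw [map_mul, hφi, hφq i hij, smul_mul_smul_comm, ← jacobiSym.mul_left, show (-1 : ℤ) * -(q i : ℤ) = q i by ring]
    rw [hmul, bit_zsmul_eq_addLegendreSym (im_mul_sqrtNeg_ne_zero D (hqn i)) hJq, legendreMatrix_apply_of_ne q (Ne.symm hij)]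
  rcases c with i | u
  · simp only [Sum.elim_inl, Matrix.fromBlocks_apply₁₁]
    by_cases hij : i = j
    · subst hij
      -- the diagonal bit from the block relation over the family `(2; q)`
      have hrel := bit_sqrtNeg_eq_bit_im_add_sum D (Fin.cons 2 q) hd hprod' φ
      rw [if_pos hφd, Fin.sum_univ_succ] at hrel
      simp only [Fin.cons_zero, Fin.cons_succ] at hrel
      rw [hbi, hb2, ← Finset.add_sum_erase _ _ (mem_univ i),
        Finset.sum_congr rfl (fun l hl => hoff l (ne_of_mem_erase hl))] at hrel
      rw [Matrix.add_apply, legendreMatrix_apply_self]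
      unfold legendreDiagonal
      rw [diagonal_apply_eq, show (-2 : ℤ) = (-1) * 2 by norm_num, addLegendreSym_mul_of_ne_zero hJi hJ2]
      -- solve `0 = a + (b + (x + s))` for `x`
      have e : ∀ a b x s : ZMod 2, 0 = a + (b + (x + s)) → x = s + (a + b) := by decide
      exact e _ _ _ _ hrel
    · rw [hoff i hij, Matrix.add_apply]
      unfold legendreDiagonal
      rw [diagonal_apply_ne _ (Ne.symm hij), add_zero]
  · simp only [Sum.elim_inr, Matrix.fromBlocks_apply₁₂, Matrix.of_apply]
    exact hb2

end Summit.BirchSwinnertonDyer.PrintCf2.MoverAssembly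

end
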